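import Literature.Computability.Learning.ColumnPredictorFP
import Literature.Computability.Learning.ModpTables
import HarnessLib

/-!
# The `AC⁰[p]` learner: its column program for the generic table-based NW predictor

Machine-layer groundwork for the named fact `Literature.Computability.Learning.cikk_learn_AC0Mod`
(CIKK 2016, Cor. 5.4). The generic predictor of `ColumnPredictorFP.lean` is parametrised by a
column program; here is the one of the `AC⁰[p]`-computable design `designP` (`ModpTables.lean`):
`Modp.colValFn`, the column function `Modp.colFn` of `ModpDesignFP.lean` (the program `colValL` of
`GFDesignList.lean`) on the design context, with `colValFn_mem_FP`, its specification
`cvSpec_colValFn` (`ColDesign.CvSpec` with `cv q ℓ vbits τ = colValL 𝔭 q ℓ vbits τ`), and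
`cvFin_colValP` identifying the generic column values with `Modp.colVal`; whence
**`predFn_eq_nwPredictor`** for `designP` as an instance of the generic theorem.

## References

* M. Carmosino, R. Impagliazzo, V. Kabanets, A. Kolokolova, *Learning algorithms from natural
  proofs*, CCC 2016, §2.4, Thm. 3.6 [CarmosinoImpagliazzoKabanetsKolokolova2016].
-/

namespace Literature.Computability.Learning

namespace Modp

open Literature.Computability.Complexity Literature.Computability.Complexity.Brick
  Literature.Computability.Complexity.Plumb Literature.Computability.MetaComplexity
  Literature.Computability.MetaComplexity.GFDesign Literature.Computability.Cryptography _root_.Computability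

variable [P : PrimeP]

/-- **The column program of the `AC⁰[p]` learner**: `colValL 𝔭 Q ℓ v τ` on `⟨⟨hdr, vbits⟩, 1^τ⟩`
(binary numeral), the column function of `ModpDesignFP.lean` on the design context.
[cite: CarmosinoImpagliazzoKabanetsKolokolova2016, §3.1 / Thm. 3.6] -/
noncomputable def colValFn : List Bool → List Bool :=
  colFn ∘ fanoutFn (mkCtxFn ∘ fstF) sndF

/-- `colValFn ∈ FP`. [folklore] -/
theorem colValFn_mem_FP : colValFn ∈ FP :=
  comp_mem_FP colFn_mem_FP (fanoutFn_mem_FP (comp_mem_FP mkCtxFn_mem_FP fstF_mem_FP) sndF_mem_FP)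

/-- The column values computed by the program. [folklore] -/
def colValP (q ℓ : ℕ) (vbits : List Bool) (τ : ℕ) : ℕ := colValL 𝔭 q ℓ vbits τ

/-- **The column program meets its specification.** [folklore] -/
theorem cvSpec_colValFn : ColDesign.CvSpec colValFn colValP := by
  intro pad q ℓ n' L vbits τ
  rw [colValFn, Function.comp_apply, fanoutFn_apply]
  simp only [Function.comp_apply, fstF_boolPair, sndF_boolPair, mkCtxFn_apply, colFn_apply, colValP]

/-- The generic column values of the blocks are `Modp.colVal`. [folklore] -/
theorem cvFin_colValP (q ℓ : ℕ) : ColDesign.cvFin colValP q ℓ = colVal q ℓ := rfl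

/-- **The machine predictor is the NW predictor of the `AC⁰[p]` learner** (instance of
`ColDesign.predFn_eq_nwPredictor` for `designP`). [cite: CarmosinoImpagliazzoKabanetsKolokolova2016, Thm. 2.11 (reconstruction algorithm)] -/
theorem predFn_eq_nwPredictor {t n' ℓ : ℕ} (ht : t ≠ 0) (hn : n' ≤ 𝔭 ^ t) (R : CombinatorialProperty)
    {dR : List Bool → List Bool} (hdR : ∀ y, dR y = encodeBool ((truthTableLanguage R).boolIndicator y))
    (pad : List Bool) (g : (Fin n' → Bool) → Bool) (i : Fin (2 ^ ℓ)) (z : Fin (𝔭 ^ t * 𝔭 ^ t) → Bool)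
    (w : Fin (2 ^ ℓ) → Bool) (x : Fin n' → Bool) (tbls : List (List Bool))
    (htbls : ∀ j : Fin (2 ^ ℓ), (j : ℕ) < i →
      tbls.getD j [] = ColDesign.tableList (colVal (𝔭 ^ t) ℓ) (designP ht n' ℓ hn) g i j z) :
    ColDesign.predFn colValFn dR (boolPair (predRec (predHdr pad (𝔭 ^ t) ℓ n' (2 ^ ℓ))
      (List.ofFn ((boolFunEquivFin ℓ).symm i)) (List.ofFn w) (OracleCompose.body tbls) (List.ofFn z))
      (List.ofFn x)) = [nwPredictor (designP ht n' ℓ hn) g (natTest R ℓ) i z w x] :=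
  ColDesign.predFn_eq_nwPredictor cvSpec_colValFn (isColumnDesign_designP ht hn) (isNWDesign_designP ht n' ℓ hn)
    R hdR pad g i z w x tbls htbls

end Modp

end Literature.Computability.Learning
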